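/-
Copyright (c) 2026 the pub-hodgecm-mathlib formalisation cell (harness21).  Prover seat hodgecm-mathlib-K2E4-p17 (g0),
Track B «K2-LIT» ∕ h413, line `K2_E4_SingularTransferKappaSign`, follow-on pool item H5 (dealer K2E4-plan (g0) 21:06:32Z), part 2 of 2:
the `e₁`-EIGENPLANE ANISOTROPY predicates of sockets #8 `sig_K2E4KottwitzSignOfSheets` ∕ #18 `sig_K2E4KottwitzSignParity`, at a finite non-split place
and at a complex place, READ AS HILBERT SYMBOLS `(d, θ) = −1` of ONE global `d = −det g(p,q) ∈ L⁺`.  2026-09-03.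
-/
import Summits.HodgeConjecture.HodgeConjecture.Theorems.K2E4HermitianPlaneIsotropicIffNorm   -- part 1: plane criterion, Gram matrices, base change
import Literature.NumberTheory.Rogawski1990.ExplicitFactorProductFormulaParts        -- ★ `hilbertSymbol_equivInfinitePlace_eq_sign` (real places: the symbol is a sign)
import Literature.NumberTheory.Rogawski1990.FinExplicitTransferFactorConjRight       -- ★ `isUnit_localRing_of_ne_zero_of_subsingleton` (`E_v` is a field at non-split `v`)
import Literature.NumberTheory.Automorphic.QuadraticLocalNormResidueBridge           -- ★ `UnitaryGroup.exists_isUnit_algebraMap_eq_mul_conjLocal_iff` (unit-norm test = Hilbert symbol)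
import HarnessLib

/-!
# K2_E4 road (h413 = stmt-HodgeConjecture-24833), pool item H5, part 2: the eigenplane anisotropy predicates of sockets #8 ∕ #18 are Hilbert symbols
# `(d, θ)_v = −1` (finite non-split `v`), `(d, θ)_{w|L⁺} = −1` (infinite `w`), `d = −det g(p,q)`

Cell `pub/hodgecm-mathlib` (D-0151), Track B (21-frontier RULING «PUSH BOTH» 2026-09-03, director req624, chair K2-lead ORDER #1 §4.4 ∕ ORDER #2,
naming rule s1813), dealer's pool `K2/K2E4-plan/g0/DEALS.K2E4-g0.md` item **H5** (consumers: sockets #8 `sig_K2E4KottwitzSignOfSheets` — Kottwitz sign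
`e(U(W₂)_v) = −1` iff `W₂ ⊗ L⁺_v` anisotropic — and #18 `sig_K2E4KottwitzSignParity` — the number of finite non-split `v` with `W₂,v` anisotropic plus the
number of infinite `w` with `W₂,w` definite is EVEN).  Part 1 = ★ `Theorems/K2E4HermitianPlaneIsotropicIffNorm` (the plane criterion over a commutative ring
which is a field, Gram matrices, base change of `ker (M − e₁)`).

THE MATHEMATICS.  `L` CM, `c` its conjugation, `L = L⁺(√θ)` with `θ` = ★ `cmQuadraticGenerator` totally negative.
* §1 the two NORM READINGS for `x ∈ (L⁺)^×`: at a finite place `v` of `L⁺` with one place of `L` above it (`E_v = ∏_{w∣v} L_w` a field,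
  `isField_localRing_of_subsingleton`), «`¬ ∃ z ∈ E_v, (c⊗1)(z)·z = x ⊗ 1`» iff `(x, θ)_v = −1` (★ `UnitaryGroup.exists_isUnit_algebraMap_eq_mul_conjLocal_iff`,
  O'Meara §65A «`α` is a local norm at `𝔭` iff `(α, θ∕𝔭) = 1`», and the symbol is `±1`); at an infinite place `w` of `L`, «`¬ ∃ z ∈ ℂ, z̄ z = σ_w(x)`» iff
  `σ_w(x) < 0` (`σ_w(x)` is real) iff `(x, θ)_{w|L⁺} = −1` (★ `hilbertSymbol_equivInfinitePlace_eq_sign`: at a real place with `θ < 0` the symbol is the sign).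
* §2 **THE TWO CONSUMER THEOREMS.**  Data: `H ∈ M_n(L)` `c`-hermitian, `M ∈ M_n(L)` with `(M − e₁)(M − e₂) = 0`, `e₁ ≠ e₂` (the singular `γ₀`), an
  `L`-basis `p, q` of `ker (M − e₁)` (in the kernel, independent, spanning — part 1's `exists_pair_of_finrank_ker_eq_two` produces it from H1's
  `finrank = 2`), and `d ∈ (L⁺)^×` with `d = −det g(p,q)` (`exists_neg_det_gram_eq_algebraMap`).  Then the socket predicates, VERBATIM in shape,
  «`∀ x ∈ E_v^n, (M ⊗ 1 − e₁) x = 0 → Σ_{i,j} (c⊗1)(x_i) H_{ij} x_j = 0 → x = 0`» and «`∀ x ∈ ℂ^n, (σ_w M − σ_w e₁) x = 0 → Σ x̄_i σ_w(H_{ij}) x_j = 0 → x = 0`»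
  are equivalent to `(d, θ)_v = −1`, resp. `(d, θ)_{w|L⁺} = −1` (`kerPlane_anisotropic_localRing_iff_hilbertSymbol_eq_neg_one`,
  `kerPlane_anisotropic_embedding_iff_hilbertSymbol_eq_neg_one`): part 1 §3 moves the plane and its independence to `E_v` ∕ `ℂ`, part 1 §2 is the plane
  criterion there, part 1 §1 identifies the local Gram determinant with `−d ⊗ 1`, and §1 here reads the norm condition as a symbol.  So #18's parity
  is Hilbert reciprocity for the single element `d` (★ `finprod_hilbertSymbol_mul_prod_infinitePlace_hilbertSymbol_eq_one`; split `v` contribute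
  `(d, θ)_v = +1`, ★ `hilbertSymbol_eq_one_of_not_subsingleton`), and #8's sign is `(d, θ)_v`.

HONEST LABEL: HC_CM is proved only modulo the 7 printed citations (2 remaining named inputs: hLiu418 = stmt-HodgeConjecture-24832, h413 =
stmt-HodgeConjecture-24833) until rung 0 closes; this file is a `--supports stmt-HodgeConjecture-24833` helper and retires nothing by itself.

## References
* [Jacobowitz1962] R. Jacobowitz, *Hermitian forms over local fields*, Amer. J. Math. 84 (1962), §3 Thm. 3.1.
* [Omeara1963] O. T. O'Meara, *Introduction to Quadratic Forms* (1963), §63B (the symbol over `ℝ`), §65A (local norms and the Hilbert symbol), §71 Thm. 71:18.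
* [Rogawski1990] J. D. Rogawski, *Automorphic Representations of Unitary Groups in Three Variables*, Ann. of Math. Stud. 123 (1990), §3.8 p. 33, §8.1 p. 117
  (`Γ₁^{I(j)} = (−1)^{q(I(j))} d⁻¹`), §8.2 p. 119 (the sign at the archimedean place), §14.6 p. 242.
* [Kottwitz1983] R. E. Kottwitz, *Sign changes in harmonic analysis on reductive groups*, Trans. AMS 278 (1983) (the sign `e(G)` the consumers compute).
-/

set_option autoImplicit false
-- the mandated namespace repeats the single-problem summit's segment (`HodgeConjecture.HodgeConjecture`)
set_option linter.dupNamespace false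

noncomputable section

open Matrix NumberField IsDedekindDomain
open Literature.AlgebraicGeometry.ShimuraVarieties (hermForm)
open Literature.NumberTheory.QuadraticForms (hilbertSymbol hilbertSymbol_eq_one_or_eq_neg_one)
open Literature.NumberTheory.Rogawski1990 Literature.NumberTheory.Automorphic
open Summit.HodgeConjecture.HodgeConjecture.Cruxes.H413.K2E4HermitianPlaneIsotropicIffNorm

namespace Summit.HodgeConjecture.HodgeConjecture.Cruxes.H413.K2E4EigenplaneAnisotropicIffHilbertSymbol

/-! ## §1 The CM readings of «`x` is not a norm»: finite non-split places and complex places -/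

section CM

variable (L : Type) [Field L] [NumberField L] [IsCMField L]

omit [IsCMField L] in
/-- At a place `v` of `L⁺` with ONE place of `L` above it, `E_v = ∏_{w ∣ v} L_w` is a field (★ `isUnit_localRing_of_ne_zero_of_subsingleton`).
[cite: Omeara1963, §65A] -/
theorem isField_localRing_of_subsingleton {v : HeightOneSpectrum (𝓞 ↥(maximalRealSubfield L))}
    (hsub : Subsingleton (UnitaryGroup.PlacesOver L v)) : IsField (UnitaryGroup.LocalRing L v) := by
  obtain ⟨w⟩ := (inferInstance : Nonempty (UnitaryGroup.PlacesOver L v))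
  refine ⟨⟨0, 1, fun h => zero_ne_one (congrFun h w)⟩, mul_comm, fun {a} ha => ?_⟩
  obtain ⟨u, rfl⟩ := isUnit_localRing_of_ne_zero_of_subsingleton L v hsub ha
  exact ⟨↑u⁻¹, u.mul_inv⟩

/-- `c ∘ c = id` for the complex conjugation of the CM field `L` (as the ring map ★ `cmConjRingHom`). [folklore] -/
theorem cmConjRingHom_cmConjRingHom (x : L) : cmConjRingHom L (cmConjRingHom L x) = x := by
  obtain ⟨w⟩ : Nonempty (InfinitePlace L) := inferInstance
  apply w.embedding.injective
  rw [embedding_cmConjRingHom, embedding_cmConjRingHom, starRingEnd_self_apply]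

/-- **FINITE NON-SPLIT PLACE: «`x ⊗ 1` is not a norm from `E_v`» iff `(x, θ)_v = −1`** (`x ∈ (L⁺)^×`, `θ` = ★ `cmQuadraticGenerator`; ★
`UnitaryGroup.exists_isUnit_algebraMap_eq_mul_conjLocal_iff` — O'Meara §65A «`α` is a local norm at `𝔭` iff `(α, θ∕𝔭) = 1`» — and the symbol is `±1`).
[cite: Omeara1963, §65A; §63B] [cite: Rogawski1990, §3.8 p. 33] -/
theorem not_exists_norm_localRing_iff_hilbertSymbol_eq_neg_one {v : HeightOneSpectrum (𝓞 ↥(maximalRealSubfield L))}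
    (hsub : Subsingleton (UnitaryGroup.PlacesOver L v)) {x : ↥(maximalRealSubfield L)} (hx : x ≠ 0) :
    (¬ ∃ z : UnitaryGroup.LocalRing L v, UnitaryGroup.conjLocal L (IsCMField.complexConj L) v z * z =
        algebraMap L (UnitaryGroup.LocalRing L v) (algebraMap ↥(maximalRealSubfield L) L x)) ↔
      hilbertSymbol (v.adicCompletion ↥(maximalRealSubfield L)) (x : v.adicCompletion ↥(maximalRealSubfield L))
        ((cmQuadraticGenerator L : ↥(maximalRealSubfield L)) : v.adicCompletion ↥(maximalRealSubfield L)) = -1 := by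
  obtain ⟨w⟩ := (inferInstance : Nonempty (UnitaryGroup.PlacesOver L v))
  haveI : Nontrivial (UnitaryGroup.LocalRing L v) := ⟨⟨0, 1, fun h => zero_ne_one (congrFun h w)⟩⟩
  obtain ⟨α, hα0, hαc, hαsq⟩ := cmQuadraticGenerator_spec L
  have hαα : α * α = algebraMap ↥(maximalRealSubfield L) L (cmQuadraticGenerator L : ↥(maximalRealSubfield L)) := by
    rw [← sq]; exact hαsq
  have bridge := UnitaryGroup.exists_isUnit_algebraMap_eq_mul_conjLocal_iff L (IsCMField.complexConj L) hαc hα0 hαα v hx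
  have ha0 : algebraMap L (UnitaryGroup.LocalRing L v) (algebraMap ↥(maximalRealSubfield L) L x) ≠ 0 :=
    (map_ne_zero _).2 ((map_ne_zero _).2 hx)
  have hiff : (∃ z : UnitaryGroup.LocalRing L v, UnitaryGroup.conjLocal L (IsCMField.complexConj L) v z * z =
        algebraMap L (UnitaryGroup.LocalRing L v) (algebraMap ↥(maximalRealSubfield L) L x)) ↔
      ∃ z : UnitaryGroup.LocalRing L v, IsUnit z ∧ algebraMap L (UnitaryGroup.LocalRing L v) (algebraMap ↥(maximalRealSubfield L) L x) =
        z * UnitaryGroup.conjLocal L (IsCMField.complexConj L) v z := by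
    constructor
    · rintro ⟨z, hz⟩
      have hz0 : z ≠ 0 := by
        rintro rfl
        exact ha0 (by rw [← hz, mul_zero])
      exact ⟨z, isUnit_localRing_of_ne_zero_of_subsingleton L v hsub hz0, by rw [← hz, mul_comm]⟩
    · rintro ⟨z, -, hz⟩
      exact ⟨z, by rw [hz, mul_comm]⟩
  rw [hiff, bridge]
  rcases hilbertSymbol_eq_one_or_eq_neg_one (x : v.adicCompletion ↥(maximalRealSubfield L))
      ((cmQuadraticGenerator L : ↥(maximalRealSubfield L)) : v.adicCompletion ↥(maximalRealSubfield L)) with h | h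
  · rw [h]; norm_num
  · rw [h]; norm_num

/-- Over `ℂ`: for a REAL `r`, «`r` is not a norm `z̄ z`» iff `r < 0`. [cite: Omeara1963, §63B] -/
theorem not_exists_norm_complex_iff {r : ℂ} (hr : starRingEnd ℂ r = r) :
    (¬ ∃ z : ℂ, starRingEnd ℂ z * z = r) ↔ r.re < 0 := by
  have him : r.im = 0 := Complex.conj_eq_iff_im.1 hr
  constructor
  · intro h
    by_contra hge
    push Not at hge
    apply h
    refine ⟨(Real.sqrt r.re : ℂ), ?_⟩
    rw [Complex.conj_ofReal, ← Complex.ofReal_mul, Real.mul_self_sqrt hge]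
    exact Complex.ext (by simp) (by simp [him])
  · rintro hlt ⟨z, hz⟩
    have h1 : (Complex.normSq z : ℂ) = r := by rw [Complex.normSq_eq_conj_mul_self]; exact hz
    have hre : r.re = Complex.normSq z := by rw [← h1, Complex.ofReal_re]
    linarith [Complex.normSq_nonneg z]

/-- **COMPLEX PLACE: «`σ_w(x)` is not a norm `z̄ z`» iff `(x, θ)_{w|L⁺} = −1`** (`x ∈ (L⁺)^×`; `σ_w(x)` is real, and at a real place where `θ < 0` the symbol
is the sign of `x`, ★ `hilbertSymbol_equivInfinitePlace_eq_sign`). [cite: Omeara1963, §63B] -/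
theorem not_exists_norm_embedding_iff_hilbertSymbol_eq_neg_one (w : InfinitePlace L) {x : ↥(maximalRealSubfield L)} (hx : x ≠ 0) :
    (¬ ∃ z : ℂ, starRingEnd ℂ z * z = w.embedding (algebraMap ↥(maximalRealSubfield L) L x)) ↔
      hilbertSymbol (IsCMField.equivInfinitePlace L w).Completion
          (algebraMap ↥(maximalRealSubfield L) _ x) (algebraMap ↥(maximalRealSubfield L) _ (cmQuadraticGenerator L : ↥(maximalRealSubfield L))) = -1 := by
  rw [hilbertSymbol_equivInfinitePlace_eq_sign L w hx]
  have hr : starRingEnd ℂ (w.embedding (algebraMap ↥(maximalRealSubfield L) L x)) = w.embedding (algebraMap ↥(maximalRealSubfield L) L x) := by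
    have h := x.2 w.embedding
    rwa [Complex.star_def] at h
  rw [not_exists_norm_complex_iff hr]
  rcases lt_trichotomy (w.embedding (algebraMap ↥(maximalRealSubfield L) L x)).re 0 with hlt | heq | hgt
  · simp [sign_neg hlt, hlt]
  · simp [heq]
  · simp [sign_pos hgt, not_lt.2 hgt.le]

end CM

/-! ## §2 The consumer theorems: the sockets' eigenplane anisotropy predicates as Hilbert symbols of `d = −det g(p,q)` -/

section Consumers

variable (L : Type) [Field L] [NumberField L] [IsCMField L] {n : Type*} [Fintype n] [DecidableEq n]

omit [DecidableEq n] in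
/-- **The discriminant of the plane is a real element**: for `H` `c`-hermitian and any `p, q`, `−det g(p,q) ∈ L⁺` (the Gram matrix is `c`-hermitian, so its
determinant is `c`-fixed). [cite: Jacobowitz1962, §3] -/
theorem exists_neg_det_gram_eq_algebraMap (H : Matrix n n L) (hH : (H.map (cmConjRingHom L))ᵀ = H) (p q : n → L) :
    ∃ d : ↥(maximalRealSubfield L), algebraMap ↥(maximalRealSubfield L) L d =
      -(!![hermForm (cmConjRingHom L) H p p, hermForm (cmConjRingHom L) H p q;
          hermForm (cmConjRingHom L) H q p, hermForm (cmConjRingHom L) H q q]).det := by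
  have hG := gram_hermitian (cmConjRingHom L) (cmConjRingHom_cmConjRingHom L) hH p q
  have hfix : cmConjRingHom L (!![hermForm (cmConjRingHom L) H p p, hermForm (cmConjRingHom L) H p q;
      hermForm (cmConjRingHom L) H q p, hermForm (cmConjRingHom L) H q q]).det =
      (!![hermForm (cmConjRingHom L) H p p, hermForm (cmConjRingHom L) H p q;
        hermForm (cmConjRingHom L) H q p, hermForm (cmConjRingHom L) H q q]).det := by
    conv_rhs => rw [← hG, Matrix.det_transpose]
    rw [RingHom.map_det, RingHom.mapMatrix_apply]
  have hmem : -(!![hermForm (cmConjRingHom L) H p p, hermForm (cmConjRingHom L) H p q;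
      hermForm (cmConjRingHom L) H q p, hermForm (cmConjRingHom L) H q q]).det ∈ maximalRealSubfield L := by
    rw [← IsCMField.complexConj_eq_self_iff, map_neg, ← cmConjRingHom_apply, hfix]
  exact ⟨⟨_, hmem⟩, rfl⟩

/-- **FINITE NON-SPLIT PLACE — the socket predicate «`W₂ ⊗ L⁺_v` anisotropic» is `(d, θ)_v = −1`.**  `H ∈ M_n(L)` `c`-hermitian, `(M − e₁)(M − e₂) = 0` with
`e₁ ≠ e₂`, `p, q` an `L`-basis of `ker (M − e₁)` (in ker, independent, spanning), `d ∈ (L⁺)^×` with `d = −det g(p,q)`; `v` a finite place of `L⁺` with one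
place of `L` above it.  Then «every `x ∈ E_v^n` with `(M ⊗ 1 − e₁) x = 0` and `Σ_{i,j} (c⊗1)(x_i) H_{ij} x_j = 0` is `0`» iff `(d, θ)_v = −1`.  Assembly: §3 (the
kernel over `E_v` is `E_v f(p) + E_v f(q)`, still independent), §2 at the field `E_v` (★ `isUnit_localRing_of_ne_zero_of_subsingleton`), §1 (the local Gram
matrix is `g(p,q) ⊗ 1`, determinant `−d ⊗ 1`), §4.  The anisotropy ⟺ Kottwitz sign `e(U(W₂)_v) = −1` reading of [Rogawski1990, §8.1 p. 117 `(−1)^{q(I(j))}`].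
[cite: Jacobowitz1962, §3 Thm. 3.1] [cite: Omeara1963, §65A] [cite: Rogawski1990, §3.8 p. 33; §8.1 p. 117] -/
theorem kerPlane_anisotropic_localRing_iff_hilbertSymbol_eq_neg_one (H M : Matrix n n L) (hH : (H.map (cmConjRingHom L))ᵀ = H)
    {e₁ e₂ : L} (hne : e₁ ≠ e₂) (hM : (M - e₁ • (1 : Matrix n n L)) * (M - e₂ • (1 : Matrix n n L)) = 0)
    {p q : n → L} (hp : (M - e₁ • (1 : Matrix n n L)) *ᵥ p = 0) (hq : (M - e₁ • (1 : Matrix n n L)) *ᵥ q = 0)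
    (hind : ∀ a b : L, a • p + b • q = 0 → a = 0 ∧ b = 0)
    (hspan : ∀ y : n → L, (M - e₁ • (1 : Matrix n n L)) *ᵥ y = 0 → ∃ a b : L, y = a • p + b • q)
    {d : ↥(maximalRealSubfield L)} (hd0 : d ≠ 0)
    (hd : algebraMap ↥(maximalRealSubfield L) L d =
      -(!![hermForm (cmConjRingHom L) H p p, hermForm (cmConjRingHom L) H p q;
          hermForm (cmConjRingHom L) H q p, hermForm (cmConjRingHom L) H q q]).det)
    {v : HeightOneSpectrum (𝓞 ↥(maximalRealSubfield L))} (hsub : Subsingleton (UnitaryGroup.PlacesOver L v)) :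
    (∀ x : n → UnitaryGroup.LocalRing L v,
        (M.map (algebraMap L (UnitaryGroup.LocalRing L v)) -
            algebraMap L (UnitaryGroup.LocalRing L v) e₁ • (1 : Matrix n n (UnitaryGroup.LocalRing L v))) *ᵥ x = 0 →
        (∑ i, ∑ j, UnitaryGroup.conjLocal L (IsCMField.complexConj L) v (x i) *
            algebraMap L (UnitaryGroup.LocalRing L v) (H i j) * x j) = 0 → x = 0) ↔
      hilbertSymbol (v.adicCompletion ↥(maximalRealSubfield L)) (d : v.adicCompletion ↥(maximalRealSubfield L))
        ((cmQuadraticGenerator L : ↥(maximalRealSubfield L)) : v.adicCompletion ↥(maximalRealSubfield L)) = -1 := by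
  obtain ⟨w⟩ := (inferInstance : Nonempty (UnitaryGroup.PlacesOver L v))
  haveI : Nontrivial (UnitaryGroup.LocalRing L v) := ⟨⟨0, 1, fun h => zero_ne_one (congrFun h w)⟩⟩
  have hR : IsField (UnitaryGroup.LocalRing L v) := isField_localRing_of_subsingleton L hsub
  have hcompat : ∀ y : L, algebraMap L (UnitaryGroup.LocalRing L v) (cmConjRingHom L y) =
      UnitaryGroup.conjLocal L (IsCMField.complexConj L) v (algebraMap L (UnitaryGroup.LocalRing L v) y) := fun y => by
    rw [cmConjRingHom_apply, UnitaryGroup.conjLocal_algebraMap]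
  have hu : IsUnit (algebraMap L (UnitaryGroup.LocalRing L v) (e₁ - e₂)) :=
    isUnit_localRing_of_ne_zero_of_subsingleton L v hsub ((map_ne_zero _).2 (sub_ne_zero.2 hne))
  -- the kernel over `E_v`, independence, the local Gram matrix
  have hP := ker_baseChange_iff (algebraMap L (UnitaryGroup.LocalRing L v)) M hM hu hp hq hspan
  have hind' := indep_baseChange (algebraMap L (UnitaryGroup.LocalRing L v)) hR hind
  have hgram := gram_map (cmConjRingHom L) (UnitaryGroup.conjLocal L (IsCMField.complexConj L) v)
    (algebraMap L (UnitaryGroup.LocalRing L v)) hcompat H p q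
  have hG' := hermitian_map (cmConjRingHom L) (UnitaryGroup.conjLocal L (IsCMField.complexConj L) v)
    (algebraMap L (UnitaryGroup.LocalRing L v)) hcompat
    (gram_hermitian (cmConjRingHom L) (cmConjRingHom_cmConjRingHom L) hH p q)
  rw [hgram] at hG'
  have key := plane_anisotropic_iff_not_exists_norm_of_iff (UnitaryGroup.conjLocal L (IsCMField.complexConj L) v) hR hG' hind' hP
  -- the determinant of the local Gram matrix is `−d ⊗ 1`
  rw [neg_det_gram_map (cmConjRingHom L) (UnitaryGroup.conjLocal L (IsCMField.complexConj L) v)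
    (algebraMap L (UnitaryGroup.LocalRing L v)) hcompat H p q, ← hd] at key
  rw [← not_exists_norm_localRing_iff_hilbertSymbol_eq_neg_one L hsub hd0, ← key]
  simp only [sum_sum_mul_mul_eq_hermForm]
  rfl

/-- **COMPLEX PLACE — the socket predicate «`W₂ ⊗_{σ_w} ℂ` anisotropic (definite)» is `(d, θ)_{w|L⁺} = −1`**, same data, `w` an infinite place of `L`
(`σ_w` its embedding; `L` is totally complex).  Over `ℂ` a non-degenerate hermitian plane is anisotropic iff definite iff `det > 0` iff `−det` is not a norm
`z̄ z`; `σ_w(d) < 0` iff `(d, θ)_{w|L⁺} = −1` (§4).  The definiteness ⟺ compactness of `U(W₂ ⊗ ℂ)` reading of [Rogawski1990, Prop. 8.2.1 proof p. 119].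
[cite: Jacobowitz1962, §3 Thm. 3.1] [cite: Omeara1963, §63B] [cite: Rogawski1990, §8.2 p. 119] -/
theorem kerPlane_anisotropic_embedding_iff_hilbertSymbol_eq_neg_one (H M : Matrix n n L) (hH : (H.map (cmConjRingHom L))ᵀ = H)
    {e₁ e₂ : L} (hne : e₁ ≠ e₂) (hM : (M - e₁ • (1 : Matrix n n L)) * (M - e₂ • (1 : Matrix n n L)) = 0)
    {p q : n → L} (hp : (M - e₁ • (1 : Matrix n n L)) *ᵥ p = 0) (hq : (M - e₁ • (1 : Matrix n n L)) *ᵥ q = 0)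
    (hind : ∀ a b : L, a • p + b • q = 0 → a = 0 ∧ b = 0)
    (hspan : ∀ y : n → L, (M - e₁ • (1 : Matrix n n L)) *ᵥ y = 0 → ∃ a b : L, y = a • p + b • q)
    {d : ↥(maximalRealSubfield L)} (hd0 : d ≠ 0)
    (hd : algebraMap ↥(maximalRealSubfield L) L d =
      -(!![hermForm (cmConjRingHom L) H p p, hermForm (cmConjRingHom L) H p q;
          hermForm (cmConjRingHom L) H q p, hermForm (cmConjRingHom L) H q q]).det)
    (w : InfinitePlace L) :
    (∀ x : n → ℂ,
        (M.map w.embedding - w.embedding e₁ • (1 : Matrix n n ℂ)) *ᵥ x = 0 →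
        (∑ i, ∑ j, starRingEnd ℂ (x i) * w.embedding (H i j) * x j) = 0 → x = 0) ↔
      hilbertSymbol (IsCMField.equivInfinitePlace L w).Completion
          (algebraMap ↥(maximalRealSubfield L) _ d) (algebraMap ↥(maximalRealSubfield L) _ (cmQuadraticGenerator L : ↥(maximalRealSubfield L))) = -1 := by
  have hR : IsField ℂ := Field.toIsField ℂ
  have hcompat : ∀ y : L, w.embedding (cmConjRingHom L y) = starRingEnd ℂ (w.embedding y) := embedding_cmConjRingHom L w.embedding
  have hu : IsUnit (w.embedding (e₁ - e₂)) := isUnit_iff_ne_zero.2 ((map_ne_zero _).2 (sub_ne_zero.2 hne))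
  have hP := ker_baseChange_iff w.embedding M hM hu hp hq hspan
  have hind' := indep_baseChange w.embedding hR hind
  have hgram := gram_map (cmConjRingHom L) (starRingEnd ℂ) w.embedding hcompat H p q
  have hG' := hermitian_map (cmConjRingHom L) (starRingEnd ℂ) w.embedding hcompat
    (gram_hermitian (cmConjRingHom L) (cmConjRingHom_cmConjRingHom L) hH p q)
  rw [hgram] at hG'
  have key := plane_anisotropic_iff_not_exists_norm_of_iff (starRingEnd ℂ) hR hG' hind' hP
  rw [neg_det_gram_map (cmConjRingHom L) (starRingEnd ℂ) w.embedding hcompat H p q, ← hd] at key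
  rw [← not_exists_norm_embedding_iff_hilbertSymbol_eq_neg_one L w hd0, ← key]
  simp only [sum_sum_mul_mul_eq_hermForm]
  rfl

end Consumers

end Summit.HodgeConjecture.HodgeConjecture.Cruxes.H413.K2E4EigenplaneAnisotropicIffHilbertSymbol

end
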